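import Summits.QuantumFields.YangMills.Theorems.FradkinShenkerFlowStrongPinningPoincareHeatBathDensity

/-!
# Heat-bath Poincaré inequality under a Kantorovich–Rubinstein Dobrushin condition

Fifth and last file of the abstract part of `StrongPinningPoincare`: the density step
(`variance_le_of_forall_lipAt`) and the final abstract theorem `variance_le_of_kr` — for a Gibbs
measure `μ = (lam^{⊗ι}).tilted V` on a finite product of a compact metrisable probability space,
a one-site Kantorovich–Rubinstein (Vasserstein–Dobrushin) condition with column sums `≤ 1 - κ₀`
implies the heat-bath Poincaré inequality `Var_μ(F) ≤ (2κ₀)⁻¹ ∑ᵢ ∫∫ (F x − F(x[i↦e]))² dν_i^x dμ`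
for every bounded measurable `F` (Wu 2006 / Ollivier 2009 in a coupling-free form).
-/

noncomputable section

open MeasureTheory Function Real Filter
open scoped ENNReal

namespace Summit.QuantumFields.YangMills.Theorems.StrongPinningPoincare

namespace HeatBath

section Final

variable {ι : Type*} [Fintype ι] [DecidableEq ι] [Nonempty ι] {E : Type*} [TopologicalSpace E]
  [CompactSpace E] [T2Space E] [SecondCountableTopology E] [MeasurableSpace E] [BorelSpace E]
  (lam : Measure E) [IsProbabilityMeasure lam] {V : (ι → E) → ℝ}

/-- **Density step**: if the heat-bath Poincaré inequality with constant `C ≥ 0` holds for every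
bounded continuous coordinatewise-Lipschitz observable, it holds for every bounded measurable
one (both sides are `8M`-Lipschitz for `∫ |F - G| dμ` on functions bounded by `M`, bounded
continuous functions are `L¹(μ)`-dense, clamping to `[-M, M]` is a contraction, and continuous
functions are uniformly approximated by Lipschitz ones, `exists_lipAt_approx`). [folklore] -/
theorem variance_le_of_forall_lipAt (hV : Measurable V) {B : ℝ} (hB : ∀ x, |V x| ≤ B)
    (d : E → E → ℝ) (hdc : Continuous fun p : E × E => d p.1 p.2) (hd0 : ∀ e, d e e = 0)
    (hdnn : ∀ e e', 0 ≤ d e e') (hdsymm : ∀ e e', d e e' = d e' e)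
    (hdtri : ∀ a b c, d a c ≤ d a b + d b c) (hdsep : ∀ e e', d e e' = 0 → e = e')
    {C : ℝ} (hC : 0 ≤ C)
    (hLip : ∀ (G : (ι → E) → ℝ) (L MG : ℝ), Continuous G → (∀ x, |G x| ≤ MG) → 0 ≤ L →
      (∀ (x : ι → E) (j : ι) (a : E), |G (update x j a) - G x| ≤ L * d (x j) a) →
      ProbabilityTheory.variance G ((Measure.pi fun _ : ι => lam).tilted V) ≤
        C * ∑ i, ∫ x, ∫ e, (G x - G (update x i e)) ^ 2
          ∂(lam.tilted fun e => V (update x i e)) ∂((Measure.pi fun _ : ι => lam).tilted V))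
    {F : (ι → E) → ℝ} (hF : Measurable F) {M : ℝ} (hM : ∀ x, |F x| ≤ M) :
    ProbabilityTheory.variance F ((Measure.pi fun _ : ι => lam).tilted V) ≤
      C * ∑ i, ∫ x, ∫ e, (F x - F (update x i e)) ^ 2
        ∂(lam.tilted fun e => V (update x i e)) ∂((Measure.pi fun _ : ι => lam).tilted V) := by
  haveI := isProbabilityMeasure_gibbs lam hV hB
  set μ := (Measure.pi fun _ : ι => lam).tilted V with hμ
  have hE : Nonempty E := by
    have h : (Set.univ : Set E).Nonempty := nonempty_of_measure_ne_zero (by simp : lam Set.univ ≠ 0)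
    exact ⟨h.some⟩
  have hM0 : 0 ≤ M := (abs_nonneg _).trans (hM fun _ => hE.some)
  have hn : (0 : ℝ) < Fintype.card ι := by exact_mod_cast Fintype.card_pos
  -- the two sides, as functions of the observable
  set Q : ((ι → E) → ℝ) → ℝ := fun G => ∑ i, ∫ x, ∫ e, (G x - G (update x i e)) ^ 2
    ∂(lam.tilted fun e => V (update x i e)) ∂μ with hQ
  change ProbabilityTheory.variance F μ ≤ C * Q F
  -- it suffices to get within `ε' = min ε 1`
  refine le_of_forall_pos_le_add fun ε hε => ?_
  set ε' : ℝ := min ε 1 with hε'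
  have hε'pos : 0 < ε' := lt_min hε one_pos
  have hε'le : ε' ≤ ε := min_le_left _ _
  have hε'1 : ε' ≤ 1 := min_le_right _ _
  set A : ℝ := 8 * (M + 1) * (1 + C * Fintype.card ι) with hA
  have hA8 : 8 ≤ A := by
    have h1 : (1 : ℝ) ≤ M + 1 := by linarith
    have h2 : (1 : ℝ) ≤ 1 + C * Fintype.card ι := by nlinarith
    nlinarith
  have hApos : 0 < A := by linarith
  set δ : ℝ := ε' / (2 * A) with hδ
  have hδpos : 0 < δ := by positivity
  have hδ1 : δ ≤ 1 := by
    rw [hδ, div_le_one (by positivity)]; nlinarith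
  have h2Aδ : 2 * A * δ = ε' := by rw [hδ]; field_simp
  -- Step 1: bounded continuous `L¹(μ)` approximation, clamped to `[-M, M]`
  have hFi : Integrable F μ := integrable_of_abs_le hF hM
  obtain ⟨g, hg, -⟩ := hFi.exists_boundedContinuous_integral_sub_le hδpos
  set G₁ : (ι → E) → ℝ := fun x => max (-M) (min M (g x)) with hG₁
  have hG₁c : Continuous G₁ := continuous_const.max (continuous_const.min g.continuous)
  have hG₁b : ∀ x, |G₁ x| ≤ M := fun x => by
    rw [abs_le]
    exact ⟨le_max_left _ _, max_le (by linarith) (min_le_left _ _)⟩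
  have hclamp : ∀ x, |F x - G₁ x| ≤ |F x - g x| := fun x => by
    have hFx := abs_le.1 (hM x)
    have e1 : F x = max (-M) (min M (F x)) := by
      rw [min_eq_right hFx.2, max_eq_right hFx.1]
    simp only [hG₁]
    conv_lhs => rw [e1]
    refine (abs_max_sub_max_le_max _ _ _ _).trans ?_
    rw [sub_self, abs_zero]
    refine max_le (abs_nonneg _) ((abs_min_sub_min_le_max _ _ _ _).trans ?_)
    rw [sub_self, abs_zero]
    exact max_le (abs_nonneg _) le_rfl
  have hG₁m : Measurable G₁ := hG₁c.measurable
  have hFG₁ : ∫ x, |F x - G₁ x| ∂μ ≤ δ := by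
    have i0 : Integrable (fun x => |F x - g x|) μ := (hFi.sub (g.integrable μ)).abs
    refine le_trans (integral_mono_of_nonneg (ae_of_all _ fun x => abs_nonneg _) i0
      (ae_of_all _ hclamp)) ?_
    simpa only [Real.norm_eq_abs] using hg
  -- Step 2: Lipschitz approximation of `G₁`
  obtain ⟨L, G₂, hL0, hG₂c, hG₂G₁, hG₂L⟩ :=
    exists_lipAt_approx d hdc hd0 hdnn hdsymm hdtri hdsep hG₁c hM0 hG₁b hδpos
  have hG₂m : Measurable G₂ := hG₂c.measurable
  have hG₂b : ∀ x, |G₂ x| ≤ M + 1 := fun x => by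
    calc |G₂ x| = |(G₂ x - G₁ x) + G₁ x| := by ring_nf
      _ ≤ |G₂ x - G₁ x| + |G₁ x| := abs_add_le _ _
      _ ≤ δ + M := add_le_add (hG₂G₁ x) (hG₁b x)
      _ ≤ M + 1 := by linarith
  have hFb' : ∀ x, |F x| ≤ M + 1 := fun x => (hM x).trans (by linarith)
  -- Step 3: the `L¹` distance `η ≤ 2δ`
  have hG₁i : Integrable G₁ μ := integrable_of_abs_le hG₁m hG₁b
  have hG₂i : Integrable G₂ μ := integrable_of_abs_le hG₂m hG₂b
  have hη : ∫ x, |F x - G₂ x| ∂μ ≤ δ + δ := by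
    have hpt : ∀ x, |F x - G₂ x| ≤ |F x - G₁ x| + |G₁ x - G₂ x| := fun x => abs_sub_le _ _ _
    have i1 : Integrable (fun x => |F x - G₁ x|) μ := (hFi.sub hG₁i).abs
    have i2 : Integrable (fun x => |G₁ x - G₂ x|) μ := (hG₁i.sub hG₂i).abs
    calc ∫ x, |F x - G₂ x| ∂μ ≤ ∫ x, (|F x - G₁ x| + |G₁ x - G₂ x|) ∂μ :=
          integral_mono_of_nonneg (ae_of_all _ fun x => abs_nonneg _) (i1.add i2) (ae_of_all _ hpt)
      _ = ∫ x, |F x - G₁ x| ∂μ + ∫ x, |G₁ x - G₂ x| ∂μ := integral_add i1 i2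
      _ ≤ δ + δ := by
          refine add_le_add hFG₁ ?_
          have := integral_mono_of_nonneg (μ := μ) (ae_of_all _ fun x => abs_nonneg (G₁ x - G₂ x))
            (integrable_const δ) (ae_of_all _ fun x => show |G₁ x - G₂ x| ≤ δ by
              rw [abs_sub_comm]; exact hG₂G₁ x)
          simpa only [integral_const, probReal_univ, one_smul] using this
  -- Step 4: compare both sides
  have hvar := abs_variance_sub_le lam hV hB hF hG₂m hFb' hG₂b
  have hQi : ∀ i, |∫ x, ∫ e, (G₂ x - G₂ (update x i e)) ^ 2 ∂(lam.tilted fun e => V (update x i e)) ∂μ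
      - ∫ x, ∫ e, (F x - F (update x i e)) ^ 2 ∂(lam.tilted fun e => V (update x i e)) ∂μ| ≤
      8 * (M + 1) * ∫ x, |F x - G₂ x| ∂μ := fun i => by
    rw [abs_sub_comm]
    exact abs_dirichlet_sub_le lam hV hB i hF hG₂m hFb' hG₂b
  have hLipG₂ := hLip G₂ L (M + 1) hG₂c hG₂b hL0 hG₂L
  change ProbabilityTheory.variance G₂ μ ≤ C * Q G₂ at hLipG₂
  set η := ∫ x, |F x - G₂ x| ∂μ with hηdef
  have hQle : Q G₂ ≤ Q F + Fintype.card ι * (8 * (M + 1) * η) := by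
    simp only [hQ]
    rw [← nsmul_eq_mul, ← Finset.card_univ, ← Finset.sum_const, ← Finset.sum_add_distrib]
    exact Finset.sum_le_sum fun i _ => by linarith [(abs_le.1 (hQi i)).2]
  have hV1 : ProbabilityTheory.variance F μ ≤ ProbabilityTheory.variance G₂ μ + 8 * (M + 1) * η := by
    linarith [(abs_le.1 hvar).2]
  have hη2 : η ≤ δ + δ := hη
  have hMη : 0 ≤ 8 * (M + 1) * η := by
    have : 0 ≤ η := integral_nonneg fun x => abs_nonneg _
    positivity
  calc ProbabilityTheory.variance F μ
      ≤ C * Q G₂ + 8 * (M + 1) * η := hV1.trans (add_le_add hLipG₂ le_rfl)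
    _ ≤ C * (Q F + Fintype.card ι * (8 * (M + 1) * η)) + 8 * (M + 1) * η :=
        add_le_add (mul_le_mul_of_nonneg_left hQle hC) le_rfl
    _ = C * Q F + (1 + C * Fintype.card ι) * (8 * (M + 1) * η) := by ring
    _ ≤ C * Q F + (1 + C * Fintype.card ι) * (8 * (M + 1) * (δ + δ)) := by
        gcongr
    _ = C * Q F + 2 * A * δ := by simp only [hA]; ring
    _ ≤ C * Q F + ε := by rw [h2Aδ]; linarith

/-- **Heat-bath Poincaré inequality under a Kantorovich–Rubinstein Dobrushin condition**
(the abstract theorem behind `StrongPinningPoincare`; Wu 2006, Thm. 2.1-type statement /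
Ollivier 2009, Prop. 30 + Bubley–Dyer path coupling, here proved without couplings or spectral
theory). Let `μ = (lam^{⊗ι}).tilted V` be a Gibbs measure on a finite product of a compact
metrisable probability space, `V` bounded measurable, `d` a continuous bounded metric on `E`
(compatible axioms listed), and suppose the one-site heat-bath laws satisfy, for `i ≠ j` and every
bounded measurable `L`-Lipschitz `ψ`,
`|∫ ψ dν_i^x − ∫ ψ dν_i^{x[j↦a]}| ≤ L · c i j · d(x_j, a)` with `∑_{i ≠ j} c i j ≤ 1 − κ₀`,
`0 < κ₀ ≤ 1`. Then for every bounded measurable `F`,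
`Var_μ(F) ≤ (2κ₀)⁻¹ ∑ᵢ ∫∫ (F x − F(x[i↦e]))² dν_i^x(e) dμ(x)`. [folklore] -/
theorem variance_le_of_kr (hV : Measurable V) {B : ℝ} (hB : ∀ x, |V x| ≤ B)
    (d : E → E → ℝ) (hdc : Continuous fun p : E × E => d p.1 p.2) (hd0 : ∀ e, d e e = 0)
    (hdnn : ∀ e e', 0 ≤ d e e') (hdsymm : ∀ e e', d e e' = d e' e)
    (hdtri : ∀ a b c, d a c ≤ d a b + d b c) (hdsep : ∀ e e', d e e' = 0 → e = e')
    {D : ℝ} (hdD : ∀ e e', d e e' ≤ D)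
    (c : ι → ι → ℝ) {κ₀ : ℝ} (hκ₀ : 0 < κ₀) (hκ₁ : κ₀ ≤ 1)
    (hc : ∀ j, ∑ i ∈ Finset.univ.erase j, c i j ≤ 1 - κ₀)
    (hKR : ∀ (i j : ι), i ≠ j → ∀ (x : ι → E) (a : E) (ψ : E → ℝ) (L Mψ : ℝ), Measurable ψ →
      (∀ e, |ψ e| ≤ Mψ) → 0 ≤ L → (∀ e e', |ψ e - ψ e'| ≤ L * d e e') →
      |∫ e, ψ e ∂(lam.tilted fun e => V (update x i e)) -
        ∫ e, ψ e ∂(lam.tilted fun e => V (update (update x j a) i e))| ≤ L * c i j * d (x j) a)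
    {F : (ι → E) → ℝ} (hF : Measurable F) {M : ℝ} (hM : ∀ x, |F x| ≤ M) :
    ProbabilityTheory.variance F ((Measure.pi fun _ : ι => lam).tilted V) ≤
      (2 * κ₀)⁻¹ * ∑ i, ∫ x, ∫ e, (F x - F (update x i e)) ^ 2
        ∂(lam.tilted fun e => V (update x i e)) ∂((Measure.pi fun _ : ι => lam).tilted V) := by
  have hn : (0 : ℝ) < Fintype.card ι := by exact_mod_cast Fintype.card_pos
  have hn1 : (1 : ℝ) ≤ Fintype.card ι := by exact_mod_cast Fintype.card_pos
  refine variance_le_of_forall_lipAt lam hV hB d hdc hd0 hdnn hdsymm hdtri hdsep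
    (by positivity) (fun G L MG hGc hGb hL0 hGL => ?_) hF hM
  -- Lipschitz observables: contraction + decay
  set r : ℝ := 1 - κ₀ / Fintype.card ι with hr
  have hr0 : 0 ≤ r := by
    rw [hr, sub_nonneg, div_le_one hn]; linarith
  have hmain := variance_le_of_lipContraction lam hV hB d hdD hr0
    (fun u L' Mu hu hMu hL'0 huL x j a => by
      have h := lipAt_randomScan lam hV hB d hdnn hdsymm c hc hKR u L' Mu hu hMu hL'0 huL x j a
      simpa only [hr] using h)
    hGc.measurable hGb hL0 hGL
  -- `(1 - r) = κ₀ / n`, so divide through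
  have h1r : 1 - r = κ₀ / Fintype.card ι := by rw [hr]; ring
  rw [h1r] at hmain
  have hS : 0 ≤ ∑ i, ∫ x, ∫ e, (G x - G (update x i e)) ^ 2
      ∂(lam.tilted fun e => V (update x i e)) ∂((Measure.pi fun _ : ι => lam).tilted V) :=
    Finset.sum_nonneg fun i _ => integral_nonneg fun x => integral_nonneg fun e => sq_nonneg _
  have key : κ₀ / Fintype.card ι *
      ProbabilityTheory.variance G ((Measure.pi fun _ : ι => lam).tilted V) ≤
      κ₀ / Fintype.card ι * ((2 * κ₀)⁻¹ * ∑ i, ∫ x, ∫ e, (G x - G (update x i e)) ^ 2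
        ∂(lam.tilted fun e => V (update x i e)) ∂((Measure.pi fun _ : ι => lam).tilted V)) := by
    refine hmain.trans (le_of_eq ?_)
    field_simp
  exact le_of_mul_le_mul_left key (by positivity)

end Final

end HeatBath

end Summit.QuantumFields.YangMills.Theorems.StrongPinningPoincare

end
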